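import Summits.Ventures.HodgeRepro2.T5SU11FibrationHaar
import Summits.Ventures.HodgeRepro2.T5CircleFourierProjector
import Summits.Ventures.HodgeRepro2.T5CartanCoordinates

/-!
# The Haar measure of `SU(1,1)` in Rühl's coordinates: `½ sinh 2t · dt dθ dψ`

`T5SU11FibrationHaar.integral_eq` writes every Haar measure of `SU(1,1)` (up to `c > 0`) as
`∫_𝔻 (1 - |z|²)⁻² ∫_K f(s(z) k) dk dA(z)`.  With the normalised Haar measure `haarCircle` on
`K ≅ Circle` (`T5HaarCircle`: `dψ / 2π`) and the Cartan coordinates `z = tanh t · e^{iθ}` of the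
disc (`T5CartanCoordinates.integral_ball_eq_integral_cartan`: the density becomes
`sinh t cosh t = ½ sinh 2t`), this is
`c • ∫_G f dμ = ∫_{t > 0} ∫_{θ ∈ (-π, π)} sinh t cosh t · (2π)⁻¹ ∫_0^{2π} f (s(tanh t e^{iθ}) rot(e^{iψ})) dψ dθ dt`
— Rühl's measure `½ sinh η dη (4π)⁻² dψ₁ dψ₂` up to the constant and the change of the angular
normalisations (`η = 2t`).

Blind lane: Mathlib + own prefix only; no sorry; axioms ⊆ {propext, Classical.choice, Quot.sound}.
-/

namespace Summit.Ventures.HodgeRepro2.T5SU11FibrationCartan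

open MeasureTheory MeasureTheory.Measure Metric T5PoincareMeasure T5SU11Unimodular T5SU11Fibration
  T5SU11FibrationHaar T5HaarCircle
open scoped ENNReal NNReal Real

/-- `dens z = 1 / (1 - ‖z‖²)²`. -/
lemma dens_eq_norm (z : ℂ) : dens z = 1 / (1 - ‖z‖ ^ 2) ^ 2 := by
  unfold dens
  rw [Complex.normSq_eq_norm_sq]

variable [MeasurableSpace Circle] [BorelSpace Circle]

/-- The normalised Haar measure `haarCircle = dψ / 2π` of the circle is a Haar measure
(`T5CircleFourierProjector.haarCircle_eq_haarProb`). -/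
instance instIsHaarMeasureHaarCircle : IsHaarMeasure haarCircle := by
  rw [T5CircleFourierProjector.haarCircle_eq_haarProb]
  exact T5HaarUniqueCompact.isHaarMeasure_haarProb

/-- **Rühl's coordinates**: for every Haar measure `μ` on `SU(1,1)` and every `μ`-integrable `f`,
with `c = haarScalarFactor (nu haarCircle) μ > 0`,
`c • ∫ f dμ = ∫_{t>0} ∫_{θ∈(-π,π)} sinh t cosh t • ((2π)⁻¹ • ∫_0^{2π} f (s(tanh t e^{iθ}) rot(e^{iψ})) dψ)`. -/
theorem integral_eq_cartan (μ : Measure SU11) [IsHaarMeasure μ] {E : Type*} [NormedAddCommGroup E]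
    [NormedSpace ℝ E] [CompleteSpace E] (f : SU11 → E) (hf : Integrable f μ) :
    (haarScalarFactor (nu haarCircle) μ : ℝ) • ∫ g, f g ∂μ =
      ∫ p in Set.Ioi (0 : ℝ) ×ˢ Set.Ioo (-π) π, (Real.sinh p.1 * Real.cosh p.1) •
        ((2 * π)⁻¹ • ∫ ψ in (0 : ℝ)..2 * π,
          f (sec ((Real.tanh p.1 : ℂ) * ((Real.cos p.2 : ℂ) + (Real.sin p.2 : ℂ) * Complex.I)) *
            rot (Circle.exp ψ))) := by
  rw [integral_eq haarCircle μ f hf]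
  have h : ∀ z : ℂ, dens z • ∫ u, f (sec z * rot u) ∂haarCircle =
      (1 / (1 - ‖z‖ ^ 2) ^ 2) • ((2 * π)⁻¹ • ∫ ψ in (0 : ℝ)..2 * π, f (sec z * rot (Circle.exp ψ))) := by
    intro z
    rw [dens_eq_norm, integral_haarCircle]
  simp_rw [h]
  exact T5CartanCoordinates.integral_ball_eq_integral_cartan
    (fun z => (2 * π)⁻¹ • ∫ ψ in (0 : ℝ)..2 * π, f (sec z * rot (Circle.exp ψ)))

/-- The constant of Rühl's coordinates is positive. -/
theorem haarScalarFactor_cartan_pos (μ : Measure SU11) [IsHaarMeasure μ] :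
    0 < haarScalarFactor (nu haarCircle) μ :=
  haarScalarFactor_nu_pos haarCircle μ

end Summit.Ventures.HodgeRepro2.T5SU11FibrationCartan
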